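import Summits.AtomisticToContinuum.BoseEinsteinCondensation.Theses.BECStronglyRayleigh
import Summits.AtomisticToContinuum.BoseEinsteinCondensation.Theorems.InsertionFieldDelocalisation.Negative.Toolkit
import Summits.AtomisticToContinuum.BoseEinsteinCondensation.Theorems.InsertionFieldDelocalisation.Negative.PerronExistence
import Summits.AtomisticToContinuum.BoseEinsteinCondensation.Theorems.InsertionFieldDelocalisation.Negative.Tightness
import Summits.AtomisticToContinuum.BoseEinsteinCondensation.Theorems.BECStronglyRayleighSectorGroundStatePerron
import Literature.MathematicalPhysics.QuantumLattice.XYOrderInfraredProofs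
import Literature.MathematicalPhysics.QuantumLattice.LiebMattisSectorPF
import Literature.MathematicalPhysics.QuantumLattice.HeisenbergOrderTranslationProofs
import HarnessLib

/-!
# Translation invariance of admissible sector ground vectors: stub `stub_translationInvariance` (G4)
# of line `log-insertion-infrared-bound` for crux `InsertionFieldDelocalisation`
# (stmt-AtomisticToContinuum-9673)

Hard-core bosons on `(ℤ/Lℤ)³` = the ferromagnetic spin-½ XY model `xyTorus 3 L 1`. An *admissible*
datum `ψ` (in the magnetisation sector `S³_tot = N - L³/2`, nonzero, an eigenvector of the XY
Hamiltonian at the lowest sector energy, entrywise real nonnegative) is invariant under every lattice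
translation `σ ↦ σ ∘ (· + a)` of the spin configurations.

Proof. The translate `φ σ = ψ (σ ∘ τ_a)` (`τ_a = Equiv.addRight a`) is again admissible: the XY
Hamiltonian is translation covariant (`g4ti_xyTorus_submatrix_comp_addRight`, the bond sum is
permuted by `Sym2.map τ_a`), so `φ` is an eigenvector with the same eigenvalue; the magnetisation of
`σ ∘ τ_a` is that of `σ`, so `φ` lies in the same sector; nonnegativity is inherited. By the sector
Perron–Frobenius theorem (`SectorGroundStatePerron_proof`, uniqueness up to scalars) `φ = c • ψ`;
summing the (nonnegative, not all zero) entries, `Σ φ = Σ ψ ≠ 0` forces `c = 1`.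
-/

noncomputable section

open scoped BigOperators
open Literature.MathematicalPhysics.QuantumLattice Literature.Probability.LatticeModels
open Summit.AtomisticToContinuum.BoseEinsteinCondensation.Theorems.InsertionFieldDelocalisation.Negative

set_option linter.dupNamespace false

namespace Summit.AtomisticToContinuum.BoseEinsteinCondensation.Cruxes.InsertionFieldDelocalisation.LogInsertionInfraredBound

/-- **The XY Hamiltonian of the `d`-dimensional torus is translation invariant**: relabelling the
sites by `x ↦ x + v` (tensor indices by `σ ↦ σ ∘ (· + v)`) fixes `xyTorus d L n`, since the
translation permutes the bonds of the torus graph. (The tree's `xyTorus_submatrix_comp_addRight`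
is the case `d = 2`; same proof.) Kennedy–Lieb–Shastry (1988), p. 1021. [folklore] -/
theorem g4ti_xyTorus_submatrix_comp_addRight {d : ℕ} (L : ℕ) [NeZero L] (n : ℕ)
    (v : TorusSite d L) :
    (xyTorus d L n).submatrix
        (fun σ : TensorIndex (TorusSite d L) (n + 1) => σ ∘ Equiv.addRight v)
        (fun σ => σ ∘ Equiv.addRight v) = xyTorus d L n := by
  rw [xyTorus_eq_bondSum, submatrix_finset_sum]
  refine Finset.sum_nbij' (Sym2.map (Equiv.addRight v)) (Sym2.map (Equiv.addRight v).symm)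
    (fun e he => ?_) (fun e he => ?_) (fun e _ => ?_) (fun e _ => ?_) (fun e _ => ?_)
  · exact (sym2Map_addRight_mem_edgeFinset_torusGraph L v e).2 he
  · rw [Equiv.addRight_symm]
    exact (sym2Map_addRight_mem_edgeFinset_torusGraph L (-v) e).2 he
  · simp only [Sym2.map_map, Equiv.symm_comp_self, Sym2.map_id', id_eq]
  · simp only [Sym2.map_map, Equiv.self_comp_symm, Sym2.map_id', id_eq]
  · induction e using Sym2.ind with
    | h x y =>
      simp only [Sym2.map_mk, Sym2.lift_mk, Matrix.submatrix_add, Matrix.submatrix_smul,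
        Pi.add_apply, Pi.smul_apply, spinBond_submatrix_comp]

/-- **Translates of XY eigenvectors are eigenvectors**: if `H ψ = E ψ` for `H = xyTorus d L n`,
then `φ σ = ψ (σ ∘ (· + v))` satisfies `H φ = E φ`. [folklore] -/
theorem g4ti_mulVec_translate {d : ℕ} (L : ℕ) [NeZero L] (n : ℕ) (v : TorusSite d L)
    (E : ℂ) (ψ : TensorIndex (TorusSite d L) (n + 1) → ℂ)
    (hHψ : (xyTorus d L n).mulVec ψ = E • ψ) :
    (xyTorus d L n).mulVec (fun σ => ψ (σ ∘ Equiv.addRight v)) =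
      E • fun σ => ψ (σ ∘ Equiv.addRight v) := by
  have hcov : ∀ σ σ' : TensorIndex (TorusSite d L) (n + 1),
      xyTorus d L n (σ ∘ Equiv.addRight v) (σ' ∘ Equiv.addRight v) = xyTorus d L n σ σ' :=
    fun σ σ' => congrFun (congrFun (g4ti_xyTorus_submatrix_comp_addRight L n v) σ) σ'
  funext σ
  have h1 : ((xyTorus d L n).mulVec fun σ => ψ (σ ∘ Equiv.addRight v)) σ =
      ((xyTorus d L n).mulVec ψ) (σ ∘ Equiv.addRight v) := by
    simp only [Matrix.mulVec, dotProduct]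
    calc ∑ σ', xyTorus d L n σ σ' * ψ (σ' ∘ Equiv.addRight v)
        = ∑ σ', xyTorus d L n (σ ∘ Equiv.addRight v) (σ' ∘ Equiv.addRight v) *
            ψ (σ' ∘ Equiv.addRight v) := by
          refine Finset.sum_congr rfl fun σ' _ => ?_
          rw [hcov]
      _ = ∑ σ'', xyTorus d L n (σ ∘ Equiv.addRight v) σ'' * ψ σ'' :=
          (bijective_comp_equiv (q := n + 1) (Equiv.addRight v)).sum_comp
            (fun σ'' => xyTorus d L n (σ ∘ Equiv.addRight v) σ'' * ψ σ'')
  rw [h1, hHψ]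
  rfl

/-- **Translates stay in the magnetisation sector**: the magnetisation of `σ ∘ (· + v)` is that of
`σ`. [folklore] -/
theorem g4ti_mem_spinZSector_translate {d : ℕ} (L : ℕ) [NeZero L] (n : ℕ) (v : TorusSite d L)
    (M : ℝ) (ψ : TensorIndex (TorusSite d L) (n + 1) → ℂ) (hψ : ψ ∈ spinZSector n M) :
    (fun σ => ψ (σ ∘ Equiv.addRight v)) ∈ spinZSector (Λ := TorusSite d L) n M := by
  rw [LiebMattis.mem_spinZSector_iff] at hψ ⊢
  intro σ hσ
  rw [← hψ (σ ∘ Equiv.addRight v) hσ]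
  exact (Equiv.sum_comp (Equiv.addRight v) (fun x => ((n : ℂ) / 2 - ((σ x : ℕ) : ℂ)))).symm

/-- **G4 · `stub_translationInvariance`.** Admissible data are translation invariant (Hamiltonian
covariance under `x ↦ x + a` on the torus graph + `SectorGroundStatePerron_proof` uniqueness +
nonnegativity and conservation of the entry sum pin the Perron scalar to `1`). [folklore] -/
theorem stub_translationInvariance :
    ∀ (L : ℕ) [NeZero L], 2 ≤ L → ∀ N : ℕ, 2 ≤ N → 2 * N ≤ L ^ 3 →
      ∀ ψ : TensorIndex (TorusSite 3 L) 2 → ℂ,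
        ψ ∈ spinZSector 1 ((N : ℝ) - (L : ℝ) ^ 3 / 2) → ψ ≠ 0 →
        (xyTorus 3 L 1).mulVec ψ =
          ((lowestEnergyInSector 1 (xyTorus 3 L 1) ((N : ℝ) - (L : ℝ) ^ 3 / 2) : ℝ) : ℂ) • ψ →
        (∀ σ, 0 ≤ (ψ σ).re ∧ (ψ σ).im = 0) →
        ∀ (a : TorusSite 3 L) (σ : TensorIndex (TorusSite 3 L) 2), ψ (fun x => σ (x + a)) = ψ σ := by
  intro L _ hL N _hN hNL ψ hψK hψ0 hHψ hψnn a
  have hN3 : N ≤ L ^ 3 := le_trans (Nat.le_mul_of_pos_left N Nat.zero_lt_two) hNL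
  -- the translate `φ = ψ ∘ (· ∘ τ_a)` is admissible
  set φ : TensorIndex (TorusSite 3 L) 2 → ℂ := fun σ => ψ (σ ∘ Equiv.addRight a) with hφdef
  have hHφ : (xyTorus 3 L 1).mulVec φ =
      ((lowestEnergyInSector 1 (xyTorus 3 L 1) ((N : ℝ) - (L : ℝ) ^ 3 / 2) : ℝ) : ℂ) • φ :=
    g4ti_mulVec_translate L 1 a _ ψ hHψ
  have hφK : φ ∈ spinZSector 1 ((N : ℝ) - (L : ℝ) ^ 3 / 2) :=
    g4ti_mem_spinZSector_translate L 1 a _ ψ hψK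
  -- Perron–Frobenius uniqueness: both `ψ` and `φ` are multiples of the Perron vector
  obtain ⟨ψ₀, -, -, -, -, huniq⟩ :=
    Summit.AtomisticToContinuum.BoseEinsteinCondensation.Theorems.SectorGroundStatePerron_proof
      3 L (by norm_num) hL N hN3
  obtain ⟨c₁, hc₁⟩ := huniq ψ hψK hHψ
  obtain ⟨c₂, hc₂⟩ := huniq φ hφK hHφ
  have hc₁0 : c₁ ≠ 0 := by
    rintro rfl
    exact hψ0 (by rw [hc₁, zero_smul])
  have hφc : φ = (c₂ * c₁⁻¹) • ψ := by
    rw [mul_smul, hc₁, inv_smul_smul₀ hc₁0]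
    exact hc₂
  -- the entry sums agree and are nonzero, so the scalar is `1`
  have hsum : ∑ σ, φ σ = ∑ σ, ψ σ :=
    (bijective_comp_equiv (q := 2) (Equiv.addRight a)).sum_comp ψ
  have hs0 : (∑ σ, ψ σ) ≠ 0 := by
    obtain ⟨σ₀, hσ₀⟩ := Function.ne_iff.mp hψ0
    intro h
    have hre : ∑ σ, (ψ σ).re = 0 := by rw [← Complex.re_sum, h, Complex.zero_re]
    have h0 := (Finset.sum_eq_zero_iff_of_nonneg fun σ _ => (hψnn σ).1).mp hre σ₀ (Finset.mem_univ _)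
    exact hσ₀ (Complex.ext (by rw [h0, Pi.zero_apply, Complex.zero_re])
      (by rw [(hψnn σ₀).2, Pi.zero_apply, Complex.zero_im]))
  have hcs : c₂ * c₁⁻¹ * ∑ σ, ψ σ = 1 * ∑ σ, ψ σ := by
    rw [one_mul, Finset.mul_sum, ← hsum]
    refine Finset.sum_congr rfl fun σ _ => ?_
    rw [hφc, Pi.smul_apply, smul_eq_mul]
  have hc : c₂ * c₁⁻¹ = 1 := mul_right_cancel₀ hs0 hcs
  intro σ
  have h := congrFun hφc σ
  rw [hc, one_smul] at h
  exact h

end Summit.AtomisticToContinuum.BoseEinsteinCondensation.Cruxes.InsertionFieldDelocalisation.LogInsertionInfraredBound
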